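import Summits.QuantumFields.YangMills.Theorems.FlatTubeReductionDressedNearTop
import Summits.QuantumFields.YangMills.Theorems.LuscherReductionTwistedTraceScalingOneSiteNearTopPrelim
import HarnessLib

/-!
# The DRESSED near-top amplitude for a TWO-SIDED weight — the brick field `BORateBricksCore.hTop` of «ratepack-v2» discharged from the weight's vacuum behaviour
# (route `FlatTubeReduction`, crux K1 `NearFlatRatioLaw` stmt-QuantumFields-24720, skeleton «ratepack-v2», stub `stub_coreRateOfEM`; seat `ym-line-ftr-p1` g11;
# R2b1 RECORD rung — no summit statement is proved here)

g9's `dressed_near_top` (p652213) produces the near-top amplitude `φ₀ = φ/W` of the rate-grade Born–Oppenheimer bricks for a dressed weight with `0 < W ≤ 1`.  For `L ≥ 3` the dressed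
weight exceeds `1` off the vacuum (fibre-only zero-point energy has negative curvature, `Lines/ratepack-dressing-g10.md`), and the repaired brick list `BORateBricksCore` (p661687) records only
the TWO-SIDED vacuum behaviour `|W² − 1| ≤ κ_W·orbitDist²` on the slow window together with `0 ≤ W ≤ C_W`.  THIS FILE supplies `hTop` in that setting:
* `dressed_near_top₂` — `dressed_near_top` with `W ≤ 1` replaced by `W ≤ C_W` (any constant) on `{all-upper} ∩ {orbitDist < √λ_b(B)}` (the only use of `W ≤ 1` was `‖φ‖² ≤ ‖φ/W‖²`, now
  `‖φ‖² ≤ C_W²‖φ/W‖²`, for the positivity of `‖φ₀‖²`);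
* `orbitDist_le_six_norm_zmCoord_of_upper` — on the all-upper pattern `orbitDist U ≤ 6‖zmCoord 1 U‖`;
* ★★ `hTop_of_twoSided` — for `κ_W ≥ 0` and any `C_W`: eventually in `B`, every measurable gauge-invariant `W` with `0 ≤ W ≤ C_W` and `|W² − 1| ≤ κ_W·orbitDist²` on `{orbitDist < δ₁}`, where
  `√λ_b(B) ≤ δ₁` and `κ_W·λ_b(B) ≤ 1/2`, and every window `𝒰 ⊇ {all-upper} ∩ {orbitDist < √λ_b(B)}`, admit `φ₀` (bounded measurable, gauge invariant, `supp ⊆ 𝒰`, `‖φ₀‖² > 0`) with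
  `e^{−C''λ_b(B)²}·μ₀(B)·‖φ₀‖² ≤ ⟨φ₀W, K_Bφ₀W⟩` — the body of `BORateBricksCore.hTop` at `B = L³β` (the window containment `√λ_b(L³β) ≤ δ₁(β)` is the instance's business; at the record
  window `14β^{-1/6}/L³` it holds for `L = 2` and needs a smaller quasimode cut-off for `L ≥ 3`).
HONEST FRAMING: one-site bookkeeping over p647846/p652213; the weight `W` (adapted fibres) and the other bricks are OPEN with the pooled rate twin; femto rung R2b1 (RECORD label);
not infinite volume, not a gap, not Clay.  No defs, no named facts, no `sorry`.
-/

set_option autoImplicit false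

noncomputable section

open MeasureTheory Filter Topology Real
open scoped BigOperators
open Literature.MathematicalPhysics.QuantumFieldTheory
open Literature.MathematicalPhysics.QuantumLattice

namespace Summit.QuantumFields.YangMills.Theorems.FemtoTransferGap.RateTube

open Summit.QuantumFields.YangMills.Theorems.FemtoTransferGap
open Summit.QuantumFields.YangMills.Theorems.FemtoTransferGap.TwoLattice.ConstTube

/-- On the all-upper pattern every configuration is within `6‖zmCoord 1 U‖` of the vacuum orbit. [folklore] -/
theorem orbitDist_le_six_norm_zmCoord_of_upper {U : GaugeConfig 3 1 SU2} (hU : ∀ e : Edge 3 1, 0 < scalarPart (U e)) :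
    orbitDist U ≤ 6 * ‖zmCoord 1 U‖ := by
  have hper : ∀ e : Edge 3 1, frobNorm (((U e : SU2) : Matrix (Fin 2) (Fin 2) ℂ) - 1) ≤ 2 * ‖zmCoord 1 U‖ := fun e => by
    have h1 := frobNorm_sub_one_sq_le_of_scalarPart_nonneg (hU e).le
    have h2 := sum_vecPart_sq_le_norm_zmCoord_sq U e
    have h3 : frobNorm (((U e : SU2) : Matrix (Fin 2) (Fin 2) ℂ) - 1) ^ 2 ≤ (2 * ‖zmCoord 1 U‖) ^ 2 := by nlinarith
    exact (abs_le_of_sq_le_sq' h3 (by positivity)).2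
  calc orbitDist U ≤ gaugeDist 1 U := orbitDist_le 1 _
    _ = ∑ e : Edge 3 1, frobNorm (((U e : SU2) : Matrix (Fin 2) (Fin 2) ℂ) - 1) := by
        unfold gaugeDist; simp only [TT.gaugeTransform_one']
    _ ≤ ∑ _e : Edge 3 1, 2 * ‖zmCoord 1 U‖ := Finset.sum_le_sum fun e _ => hper e
    _ = 6 * ‖zmCoord 1 U‖ := by simp; ring

/-- ★ **The dressed near-top amplitude for a two-sided weight**: `dressed_near_top` (p652213) with `W ≤ 1` replaced by `W ≤ C_W` on the support set.
[cite: Luscher1983, §3] [cite: Simon1983, Thm. 1.1] -/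
theorem dressed_near_top₂ {κW CW : ℝ} (hκW : 0 ≤ κW) :
    ∃ C'' B₀ : ℝ, 0 ≤ C'' ∧ ∀ B : ℝ, B₀ ≤ B →
      ∀ W : GaugeConfig 3 1 SU2 → ℝ, Measurable W →
        (∀ (g : Site 3 1 → SU2) (u : GaugeConfig 3 1 SU2), W (gaugeTransform g u) = W u) →
        (∀ u : GaugeConfig 3 1 SU2, (∀ e : Edge 3 1, 0 < scalarPart (u e)) → orbitDist u < Real.sqrt (bareLambda B) →
          0 < W u ∧ W u ≤ CW ∧ 1 ≤ W u ^ 2 * (1 + κW * ‖zmCoord 1 u‖ ^ 2)) →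
        ∀ 𝒰 : Set (GaugeConfig 3 1 SU2), (∀ u : GaugeConfig 3 1 SU2, (∀ e : Edge 3 1, 0 < scalarPart (u e)) → orbitDist u < Real.sqrt (bareLambda B) → u ∈ 𝒰) →
          ∃ φ₀ : GaugeConfig 3 1 SU2 → ℝ, Measurable φ₀ ∧ (∃ C : ℝ, ∀ u, |φ₀ u| ≤ C) ∧
            (∀ (g : Site 3 1 → SU2) (u : GaugeConfig 3 1 SU2), φ₀ (gaugeTransform g u) = φ₀ u) ∧ (∀ u, φ₀ u ≠ 0 → u ∈ 𝒰) ∧ 0 < l2 φ₀ φ₀ ∧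
            Real.exp (-(C'' * bareLambda B ^ 2)) * levelValue su2Rep 1 B 0 * l2 φ₀ φ₀ ≤ qform su2Rep B (fun u => φ₀ u * W u) (fun u => φ₀ u * W u) := by
  obtain ⟨C, B₀, hC0, hQ⟩ := Quasimode.exists_concentrated_quasimode_levelValue
  refine ⟨C + κW * C, max B₀ 1, by positivity, fun B hB W hWm hWg hWvac 𝒰 h𝒰 => ?_⟩
  have hB1 : 1 ≤ B := (le_max_right _ _).trans hB
  have hB0 : 0 < B := by linarith
  obtain ⟨φ, hm, ⟨C', hC'⟩, hg, hs, hpos, hq, hmom⟩ := hQ B ((le_max_left _ _).trans hB)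
  have hC'0 : 0 ≤ C' := (abs_nonneg _).trans (hC' 1)
  -- the weight on the support of `φ`
  have hWs : ∀ u, φ u ≠ 0 → 0 < W u ∧ W u ≤ CW ∧ 1 ≤ W u ^ 2 * (1 + κW * ‖zmCoord 1 u‖ ^ 2) := fun u hu => hWvac u (hs u hu).1 (hs u hu).2
  set φ₀ : GaugeConfig 3 1 SU2 → ℝ := fun u => φ u / W u with hφ₀
  -- `φ₀ W = φ`
  have hprod : (fun u => φ₀ u * W u) = φ := by
    funext u
    by_cases hu : φ u = 0
    · simp [hφ₀, hu]
    · rw [hφ₀]; dsimp only; exact div_mul_cancel₀ _ (hWs u hu).1.ne'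
  -- pointwise bounds
  have hpt : ∀ u, φ₀ u ^ 2 ≤ φ u ^ 2 * (1 + κW * ‖zmCoord 1 u‖ ^ 2) := fun u => by
    by_cases hu : φ u = 0
    · simp [hφ₀, hu]
    · obtain ⟨hW0, -, hW⟩ := hWs u hu
      rw [hφ₀]; dsimp only
      rw [div_pow, div_le_iff₀ (by positivity)]
      nlinarith [sq_nonneg (φ u), hW]
  have hpt' : ∀ u, φ u ^ 2 ≤ CW ^ 2 * φ₀ u ^ 2 := fun u => by
    by_cases hu : φ u = 0
    · simp [hφ₀, hu]
    · obtain ⟨hW0, hW1, -⟩ := hWs u hu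
      rw [hφ₀]; dsimp only
      rw [div_pow, ← mul_div_assoc, le_div_iff₀ (by positivity)]
      have : W u ^ 2 ≤ CW ^ 2 := pow_le_pow_left₀ hW0.le hW1 2
      nlinarith [sq_nonneg (φ u)]
  have hbd : ∀ u, |φ₀ u| ≤ C' * (1 + 3 * κW) := fun u => by
    by_cases hu : φ u = 0
    · have : φ₀ u = 0 := by simp [hφ₀, hu]
      rw [this, abs_zero]; positivity
    · obtain ⟨hW0, -, hW⟩ := hWs u hu
      have hz := norm_zmCoord_sq_le_three u
      have hinv : 1 / W u ≤ 1 + 3 * κW := by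
        rw [div_le_iff₀ hW0]
        have h1 : 1 ≤ W u ^ 2 * (1 + 3 * κW) := hW.trans (by
          apply mul_le_mul_of_nonneg_left _ (sq_nonneg _); nlinarith)
        nlinarith
      rw [hφ₀]; dsimp only
      rw [abs_div, abs_of_pos hW0, div_eq_mul_one_div]
      exact mul_le_mul (hC' u) hinv (by positivity) hC'0
  -- integrability
  have hi0 : Integrable (fun u => φ₀ u ^ 2) (configMeasure SU2 1) :=
    integrable_of_measurable_abs_le _ ((hm.div hWm).pow_const 2) (C := (C' * (1 + 3 * κW)) ^ 2) fun u => by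
      rw [abs_pow]; exact pow_le_pow_left₀ (abs_nonneg _) (hbd u) 2
  have hiφ : Integrable (fun u => φ u ^ 2) (configMeasure SU2 1) :=
    integrable_of_measurable_abs_le _ (hm.pow_const 2) (C := C' ^ 2) fun u => by rw [abs_pow]; exact pow_le_pow_left₀ (abs_nonneg _) (hC' u) 2
  have him : Integrable (fun u => ‖zmCoord 1 u‖ ^ 2 * φ u ^ 2) (configMeasure SU2 1) :=
    integrable_of_measurable_abs_le _ (((continuous_zmCoord 1).norm.measurable.pow_const 2).mul (hm.pow_const 2)) (C := 3 * C' ^ 2)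
      fun u => by
        rw [abs_mul, abs_pow, abs_pow, abs_norm]
        exact mul_le_mul (norm_zmCoord_sq_le_three u) (pow_le_pow_left₀ (abs_nonneg _) (hC' u) 2) (by positivity) (by norm_num)
  -- norms
  have hl2φ : l2 φ φ = ∫ u, φ u ^ 2 ∂configMeasure SU2 1 := l2_self_eq_integral_sq φ
  have hl2φ₀ : l2 φ₀ φ₀ = ∫ u, φ₀ u ^ 2 ∂configMeasure SU2 1 := l2_self_eq_integral_sq φ₀
  have hlow : l2 φ φ ≤ CW ^ 2 * l2 φ₀ φ₀ := by
    rw [hl2φ, hl2φ₀, ← integral_const_mul]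
    exact integral_mono hiφ (hi0.const_mul _) hpt'
  have hpos₀ : 0 < l2 φ₀ φ₀ := pos_of_mul_pos_right (lt_of_lt_of_le hpos hlow) (sq_nonneg CW)
  have hup : l2 φ₀ φ₀ ≤ (1 + κW * (C * bareLambda B ^ 2)) * l2 φ φ := by
    rw [hl2φ₀]
    calc ∫ u, φ₀ u ^ 2 ∂configMeasure SU2 1 ≤ ∫ u, (φ u ^ 2 + κW * (‖zmCoord 1 u‖ ^ 2 * φ u ^ 2)) ∂configMeasure SU2 1 := by
          refine integral_mono hi0 (hiφ.add (him.const_mul κW)) fun u => ?_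
          have := hpt u; dsimp only; nlinarith [this]
      _ = l2 φ φ + κW * ∫ u, ‖zmCoord 1 u‖ ^ 2 * φ u ^ 2 ∂configMeasure SU2 1 := by
          rw [integral_add hiφ (him.const_mul κW), integral_const_mul, hl2φ]
      _ ≤ (1 + κW * (C * bareLambda B ^ 2)) * l2 φ φ := by
          have := mul_le_mul_of_nonneg_left hmom hκW
          nlinarith [this, l2_self_nonneg_lat φ]
  refine ⟨φ₀, hm.div hWm, ⟨_, hbd⟩, fun g u => ?_, fun u hu => ?_, hpos₀, ?_⟩
  · rw [hφ₀]; dsimp only; rw [hg, hWg]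
  · have hφu : φ u ≠ 0 := by
      intro h; apply hu; simp [hφ₀, h]
    exact h𝒰 u (hs u hφu).1 (hs u hφu).2
  · rw [hprod]
    have hμ0 : 0 ≤ levelValue su2Rep 1 B 0 := (levelValue_su2Rep_pos (L := 1) hB0 0).le
    have hx : 1 + κW * (C * bareLambda B ^ 2) ≤ Real.exp (κW * C * bareLambda B ^ 2) := by
      have := Real.add_one_le_exp (κW * C * bareLambda B ^ 2); nlinarith [this]
    have h1 : Real.exp (-((C + κW * C) * bareLambda B ^ 2)) * l2 φ₀ φ₀ ≤ Real.exp (-(C * bareLambda B ^ 2)) * l2 φ φ := by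
      have e : Real.exp (-((C + κW * C) * bareLambda B ^ 2)) = Real.exp (-(C * bareLambda B ^ 2)) * Real.exp (-(κW * C * bareLambda B ^ 2)) := by
        rw [← Real.exp_add]; ring_nf
      rw [e, mul_assoc]
      refine mul_le_mul_of_nonneg_left ?_ (Real.exp_pos _).le
      have h2 : Real.exp (-(κW * C * bareLambda B ^ 2)) * Real.exp (κW * C * bareLambda B ^ 2) = 1 := by
        rw [← Real.exp_add, neg_add_cancel, Real.exp_zero]
      have h3 := mul_le_mul_of_nonneg_left (hup.trans (mul_le_mul_of_nonneg_right hx (l2_self_nonneg_lat φ))) (Real.exp_pos (-(κW * C * bareLambda B ^ 2))).le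
      calc Real.exp (-(κW * C * bareLambda B ^ 2)) * l2 φ₀ φ₀ ≤ Real.exp (-(κW * C * bareLambda B ^ 2)) * (Real.exp (κW * C * bareLambda B ^ 2) * l2 φ φ) := h3
        _ = l2 φ φ := by rw [← mul_assoc, h2, one_mul]
    calc Real.exp (-((C + κW * C) * bareLambda B ^ 2)) * levelValue su2Rep 1 B 0 * l2 φ₀ φ₀
        = levelValue su2Rep 1 B 0 * (Real.exp (-((C + κW * C) * bareLambda B ^ 2)) * l2 φ₀ φ₀) := by ring
      _ ≤ levelValue su2Rep 1 B 0 * (Real.exp (-(C * bareLambda B ^ 2)) * l2 φ φ) := mul_le_mul_of_nonneg_left h1 hμ0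
      _ = Real.exp (-(C * bareLambda B ^ 2)) * levelValue su2Rep 1 B 0 * l2 φ φ := by ring
      _ ≤ qform su2Rep B φ φ := hq

/-- ★★ **`hTop` from the TWO-SIDED vacuum behaviour of the dressed weight** (the field `BORateBricksCore.hTop` of «ratepack-v2» at `B = L³β`): for `κ_W ≥ 0` and any `C_W` there are
`C'' ≥ 0`, `B₀` such that for `B ≥ B₀` with `κ_W·λ_b(B) ≤ 1/2`, every measurable gauge-invariant `W` with `0 ≤ W ≤ C_W` and `|W² − 1| ≤ κ_W·orbitDist²` on `{orbitDist < δ₁}`,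
`√λ_b(B) ≤ δ₁`, and every window `𝒰 ⊇ {all-upper} ∩ {orbitDist < √λ_b(B)}` admit a near-top amplitude `φ₀` (bounded measurable, gauge invariant, `supp ⊆ 𝒰`, `‖φ₀‖² > 0`)
with `e^{−C''λ_b(B)²}·μ₀(B)·‖φ₀‖² ≤ ⟨φ₀W, K_Bφ₀W⟩`. [cite: Luscher1983, §3] [cite: Simon1983, Thm. 1.1] -/
theorem hTop_of_twoSided {κW CW : ℝ} (hκW : 0 ≤ κW) :
    ∃ C'' B₀ : ℝ, 0 ≤ C'' ∧ ∀ B : ℝ, B₀ ≤ B → κW * bareLambda B ≤ 1 / 2 →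
      ∀ (W : GaugeConfig 3 1 SU2 → ℝ) (δ₁ : ℝ), Measurable W →
        (∀ (g : Site 3 1 → SU2) (u : GaugeConfig 3 1 SU2), W (gaugeTransform g u) = W u) →
        (∀ u, 0 ≤ W u) → (∀ u, W u ≤ CW) → (∀ u, orbitDist u < δ₁ → |W u ^ 2 - 1| ≤ κW * orbitDist u ^ 2) →
        Real.sqrt (bareLambda B) ≤ δ₁ →
        ∀ 𝒰 : Set (GaugeConfig 3 1 SU2), (∀ u : GaugeConfig 3 1 SU2, (∀ e : Edge 3 1, 0 < scalarPart (u e)) → orbitDist u < Real.sqrt (bareLambda B) → u ∈ 𝒰) →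
          ∃ φ₀ : GaugeConfig 3 1 SU2 → ℝ, Measurable φ₀ ∧ (∃ C : ℝ, ∀ u, |φ₀ u| ≤ C) ∧
            (∀ (g : Site 3 1 → SU2) (u : GaugeConfig 3 1 SU2), φ₀ (gaugeTransform g u) = φ₀ u) ∧ (∀ u, φ₀ u ≠ 0 → u ∈ 𝒰) ∧ 0 < l2 φ₀ φ₀ ∧
            Real.exp (-(C'' * bareLambda B ^ 2)) * levelValue su2Rep 1 B 0 * l2 φ₀ φ₀ ≤ qform su2Rep B (fun u => φ₀ u * W u) (fun u => φ₀ u * W u) := by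
  -- `1 ≤ W²(1 + 2κ_W·orbitDist²) ≤ W²(1 + 72κ_W‖zm‖²)` on the support
  obtain ⟨C'', B₀, hC''0, h⟩ := dressed_near_top₂ (κW := 72 * κW) (CW := CW) (by positivity)
  refine ⟨C'', max B₀ 1, hC''0, fun B hB hκB W δ₁ hWm hWg hW0 hWC hWsq hδ₁ 𝒰 h𝒰 => ?_⟩
  have hB1 : 1 ≤ B := (le_max_right _ _).trans hB
  have hB0 : 0 < B := by linarith
  have hlam0 : 0 < bareLambda B := bareLambda_pos' hB0
  refine h B ((le_max_left _ _).trans hB) W hWm hWg (fun u hup hud => ?_) 𝒰 h𝒰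
  have hd0 : 0 ≤ orbitDist u := orbitDist_nonneg u
  have hdδ : orbitDist u < δ₁ := lt_of_lt_of_le hud hδ₁
  have hsq := hWsq u hdδ
  -- `y = κ_W d² ≤ κ_W λ_b ≤ 1/2`
  have hd2 : orbitDist u ^ 2 ≤ bareLambda B := by
    have h1 : orbitDist u ^ 2 ≤ Real.sqrt (bareLambda B) ^ 2 := pow_le_pow_left₀ hd0 hud.le 2
    rwa [Real.sq_sqrt hlam0.le] at h1
  have hy : κW * orbitDist u ^ 2 ≤ 1 / 2 := (mul_le_mul_of_nonneg_left hd2 hκW).trans hκB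
  have hy0 : 0 ≤ κW * orbitDist u ^ 2 := by positivity
  have hWlow : 1 - κW * orbitDist u ^ 2 ≤ W u ^ 2 := by have := (abs_le.mp hsq).1; linarith
  have hWpos : 0 < W u := by
    have h2 : 0 < W u ^ 2 := by linarith
    rcases (hW0 u).lt_or_eq with hlt | heq
    · exact hlt
    · rw [← heq] at h2; simp at h2
  refine ⟨hWpos, hWC u, ?_⟩
  -- `1 ≤ (1 − y)(1 + 2y) ≤ W²(1 + 2y)` and `d² ≤ 36‖zm‖²`
  have hz : orbitDist u ^ 2 ≤ 36 * ‖zmCoord 1 u‖ ^ 2 := by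
    have h6 := orbitDist_le_six_norm_zmCoord_of_upper hup
    have : orbitDist u ^ 2 ≤ (6 * ‖zmCoord 1 u‖) ^ 2 := pow_le_pow_left₀ hd0 h6 2
    nlinarith
  have h1 : 1 ≤ W u ^ 2 * (1 + 2 * (κW * orbitDist u ^ 2)) := by
    have key : 1 ≤ (1 - κW * orbitDist u ^ 2) * (1 + 2 * (κW * orbitDist u ^ 2)) := by nlinarith
    exact key.trans (mul_le_mul_of_nonneg_right hWlow (by positivity))
  calc (1 : ℝ) ≤ W u ^ 2 * (1 + 2 * (κW * orbitDist u ^ 2)) := h1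
    _ ≤ W u ^ 2 * (1 + 72 * κW * ‖zmCoord 1 u‖ ^ 2) := by
        refine mul_le_mul_of_nonneg_left ?_ (sq_nonneg _)
        nlinarith [mul_le_mul_of_nonneg_left hz hκW]

end Summit.QuantumFields.YangMills.Theorems.FemtoTransferGap.RateTube

end
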